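import Literature.AnabelianGeometry.AbsoluteAnabelian.LogFrobeniusDiagram

/-!
# [AbsTopIII] Corollary 3.6: MLF-Galois-theoretic mono-anabelian log-Frobenius compatibility

Statements-first typing (D-0014) of S. Mochizuki, *Topics in Absolute Anabelian Geometry III*,
Corollary 3.6 (i)–(v), pp. 78–80 of the author's manuscript (lit key `paper:url-5493eb38cbb7`;
journal pagination not held; bib key `MochizukiAbsTopIII2015`).  Statement core drafted by seat
abc-iut-L4-t2 (`LogFrobeniusCompatibility.lean`, handed over 2026-08-25 per L4 ruling ν) and
re-cut here; the INPUT — the six-row diagram of categories `𝒟` of Cor. 3.6 p. 78 built as a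
`DiagramOfCategories` on the quiver `LFVertex` from the abstract categorical data
`LogFrobeniusData` (`𝒳, 𝒩, ℰ, Anab; log, λ^×, λ^{×pf}, ι_log, ι_×, κ_An, φ_An, η_An`), with its
truncations `𝒟_{≤n} = sub n` and `sub3` — is abc-iut-L4-t2's `LogFrobeniusDiagram.lean`,
imported, never re-declared.

This file: items (i), (iii), the first half of (iv), (v).  The telecore items — (ii), the second
half of (iv) — and the assembled `Prop`-structure `LogFrobeniusCompatible` (one field per printed
item) are in `FrobeniusPictureMLFTelecore.lean`.

## How each printed item is typed (and what is pinned)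

All five items are `Prop`s ON THE ABSTRACT DATA `Δ : LogFrobeniusData` (typing shape (1) of the
L4 policy: statements over abstract categorical input; the MLF model — `𝒳 = 𝒞^{MLF-sB}_T`,
`ℰ = 𝒯𝒢^{sB}`, `Anab` "constructed via the group-theoretic algorithms of Corollary 1.10" — is an
INSTANCE to be supplied by the Def. 3.1 / Cor. 1.10 files; a junk `Δ` only falsifies
`LogFrobeniusCompatible Δ τ` for itself).  Compared with the handed-over draft, every existential
below is PINNED to the printed structure, because an unpinned "∃ observable with observation
category `ℰ`" is satisfiable by constant functors and identity homotopies (vacuous):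

* (i) `CoreStmt4/5/6`: the observable "`𝒟_{≤n}` on `𝒟_{≤n-1}`" has its shape and functors
  FIXED (the single printed edge `𝒩 → ℰ`, resp. `κ_An : ℰ → Anab`, resp. `Anab → ℰ`); only the
  family of homotopies is quantified: "admits a structure of core".
* (ii) `TelecoreStmt`: the core is the one of (i) for `n = 5`; the telecore edges are EXACTLY one
  `φ_⋏ : Anab → 𝒳` per `⋏ ∈ L† = L ∪ {□}` with functor `φ_An` (`φ₁` on the first row, see
  `TelecoreData`); the contact structure `ℋ_An` is a family compatible with the telecore family
  and GENERATED (Def. 3.5 (ii)) by the printed pairs `{η_{□⋎}, η_{□⋎}⁻¹, η_⋏, η_⋏⁻¹}` with the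
  printed natural transformations on the generators (identity; `η_An`).
* (iii) `ObservableLogStmt`: a family on `𝒟_{≤3}` GENERATED by the pairs of types (1), (2) of the
  proof (p. 81) with homotopies `ι_{log,⋎}`, `ι_×` on the generators (type (3) = the reflexive
  pairs, automatic), which "determines an observable `𝔖_log` on `𝒟_{≤2}`" (`logObs`).
* (iv) BOTH incompatibilities: `IncompatibleStmt` (no family on `𝒟_{≤3}` contains would-be core
  isomorphisms `([id_{⋎+1}], [id_⋎]∘[log])` together with the `𝔖_log` generators — abc-iut-L4-t2's
  typing, which implies the printed "`𝒟_{≤2}` does not admit a structure of core on `𝒟_{≤1}`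
  compatible with `𝔖_log`": a compatible core yields such a family) and `TelecoreIncompatibleStmt`
  (for every telecore/contact datum as in (ii), no family on the telecore diagram contains the
  telecore pairs, the contact generators and the `𝔖_log` generators — implies the printed
  "`𝔗_An`, `ℋ_An`, `𝔖_log` are not simultaneously compatible").
* (v) `NexusRigidStmt` (`□` is a nexus, `𝒟` totally `□`-rigid) and `ShiftStmt` (the `ℤ`-action by
  nexus-classes of self-equivalences, WITH the action law up to 2-isomorphism).

NOT typed literally (recorded): the compatibility clauses "compatible with the families of
homotopies that constitute the core and telecore structures of (i), (ii)" in (iii) and the two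
compatibility sentences closing (v) — they compare families living on different presentations of
sub-diagrams (`𝒟_{≤3}` as `sub3`, `𝒟_{≤4}` ∪ telecore edges) and need transport of families along
graph embeddings, which `DiagramsOfCategories.lean` does not yet provide.  The CONTENT of the
(iii) clause (proof p. 81: `ι_{log,⋎}`, `ι_×` leave the Galois groups undisturbed) is typed as
`IotaOverGaloisStmt` in `FrobeniusPictureMLFTelecore.lean`.
-- TODO(general form): Cor. 3.6 (iii) second clause (literal) and (v) last two sentences.

On `X₁`/`toNexus`: `LogFrobeniusData` carries a separate first-row category `X₁` with
`toNexus : X₁ ⥤ X` so that Cor. 3.7 (`X₁ = 𝒳 ×_ℰ 𝒳`, `pr_⋎`) reuses it; Cor. 3.6 / 4.5 are the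
case `X₁ = 𝒳`, `toNexus = id_⋎ = 𝟭`.  The first-row telecore edges and their `η_⋎` therefore
enter through `TelecoreData` (`φ₁`, `e : φ₁ ⋙ toNexus ≅ φ`, `η₁`), instantiated in the printed
case by `φ₁ := φ_An`, `e :=` the unitor (so `η_{□⋎}` IS the identity), `η₁ := η_An`.
Nothing here takes a side on inter-universal Teichmüller theory; [AbsTopIII] is a refereed paper.
-/

namespace Literature.AnabelianGeometry.AbsoluteAnabelian

open _root_.CategoryTheory _root_.Quiver

universe u

namespace LFVertex

/-- The edge `𝒩 → ℰ` (row 3 → row 4) of `Γ⃗_𝒟`. [cite: MochizukiAbsTopIII2015, Corollary 3.6 p.78] -/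
def edge34 : (third : LFVertex) ⟶ fourth := PUnit.unit

/-- The edge `κ_An : ℰ → Anab` (row 4 → row 5) of `Γ⃗_𝒟`. [cite: MochizukiAbsTopIII2015, Corollary 3.6 p.78] -/
def edge45 : (fourth : LFVertex) ⟶ fifth := PUnit.unit

/-- The edge `Anab → ℰ` (row 5 → row 6) of `Γ⃗_𝒟`. [cite: MochizukiAbsTopIII2015, Corollary 3.6 p.78] -/
def edge56 : (fifth : LFVertex) ⟶ sixth := PUnit.unit

end LFVertex

namespace LogFrobeniusData

open DiagramOfCategories

variable (Δ : LogFrobeniusData.{u})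

/-! ### Corollary 3.6 (i): `ℰ`, `Anab`, `ℰ` form cores -/

/-- Observation-edge shape "`𝒟_{≤4}` on `𝒟_{≤3}`": the single edge `𝒩 → ℰ` out of the row-3
vertex. [cite: MochizukiAbsTopIII2015, Corollary 3.6 (i) p.79] -/
def coreI4 : SubVertex {a : LFVertex | a.row ≤ 3} → Type u
  | ⟨.third, _⟩ => PUnit
  | ⟨.row1 _, _⟩ => PEmpty
  | ⟨.nexus, _⟩ => PEmpty
  | ⟨.fourth, _⟩ => PEmpty
  | ⟨.fifth, _⟩ => PEmpty
  | ⟨.sixth, _⟩ => PEmpty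

/-- The shape `𝒟_{≤3} ∪ {ℰ}` (no telecore edges). [cite: MochizukiAbsTopIII2015, Corollary 3.6 (i) p.79] -/
def coreShape4 : ExtShape.{u} (SubVertex {a : LFVertex | a.row ≤ 3}) where
  I := coreI4.{u}
  J _ := PEmpty

/-- Extension data: `ℰ` at the observation vertex, the functor `𝒩 → ℰ` on the edge.
[cite: MochizukiAbsTopIII2015, Corollary 3.6 (i) p.79] -/
def coreExt4 : (Δ.sub 3).ExtData coreShape4.{u} where
  S := Δ.E
  obsMap {a} i := match a, i with
    | ⟨.third, _⟩, _ => Δ.NtoE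
    | ⟨.row1 _, _⟩, i => PEmpty.elim i
    | ⟨.nexus, _⟩, i => PEmpty.elim i
    | ⟨.fourth, _⟩, i => PEmpty.elim i
    | ⟨.fifth, _⟩, i => PEmpty.elim i
    | ⟨.sixth, _⟩, i => PEmpty.elim i
  telMap j := PEmpty.elim j

/-- `𝒟_{≤4}` presented as `𝒟_{≤3}` extended by the observation vertex `ℰ`.
[cite: MochizukiAbsTopIII2015, Corollary 3.6 (i) p.79] -/
def core4Diagram : DiagramOfCategories coreShape4.{u}.Vertex := (Δ.sub 3).extend Δ.coreExt4

/-- The observable `(𝒟_{≤4}, v = ℰ, ℋ)` on `𝒟_{≤3}` determined by a family of homotopies `ℋ` whose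
boundary paths end at `ℰ`. [cite: MochizukiAbsTopIII2015, Corollary 3.6 (i) p.79] -/
def coreObs4 (H : Δ.core4Diagram.HomotopyFamily)
    (hH : ∀ ⦃a b : coreShape4.{u}.Vertex⦄ ⦃p q : Path a b⦄, H.E p q → b = coreShape4.{u}.obs) :
    (Δ.sub 3).Observable where
  shape := coreShape4
  isEmpty_J _ := inferInstanceAs (IsEmpty PEmpty)
  ext := Δ.coreExt4
  H := H
  terminal_obs := hH

/-- **Cor. 3.6 (i), `n = 4`**: "`𝒟_{≤4}` admits a natural structure of core on `𝒟_{≤3}`", i.e.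
"`ℰ` forms a core of the functors in `𝒟`": some family of homotopies makes the observable
`(𝒟_{≤4}, ℰ)` a core. [cite: MochizukiAbsTopIII2015, Corollary 3.6 (i) p.79] -/
def CoreStmt4 : Prop := ∃ H hH, (Δ.coreObs4 H hH).IsCore

/-- Observation-edge shape "`𝒟_{≤5}` on `𝒟_{≤4}`": the single edge `κ_An : ℰ → Anab`.
[cite: MochizukiAbsTopIII2015, Corollary 3.6 (i) p.79] -/
def coreI5 : SubVertex {a : LFVertex | a.row ≤ 4} → Type u
  | ⟨.fourth, _⟩ => PUnit
  | ⟨.row1 _, _⟩ => PEmpty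
  | ⟨.nexus, _⟩ => PEmpty
  | ⟨.third, _⟩ => PEmpty
  | ⟨.fifth, _⟩ => PEmpty
  | ⟨.sixth, _⟩ => PEmpty

/-- The shape `𝒟_{≤4} ∪ {Anab}` (no telecore edges). [cite: MochizukiAbsTopIII2015, Corollary 3.6 (i) p.79] -/
def coreShape5 : ExtShape.{u} (SubVertex {a : LFVertex | a.row ≤ 4}) where
  I := coreI5.{u}
  J _ := PEmpty

/-- Extension data: `Anab` at the observation vertex, `κ_An` on the edge.
[cite: MochizukiAbsTopIII2015, Corollary 3.6 (i) p.79] -/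
def coreExt5 : (Δ.sub 4).ExtData coreShape5.{u} where
  S := Δ.A
  obsMap {a} i := match a, i with
    | ⟨.fourth, _⟩, _ => Δ.κ
    | ⟨.row1 _, _⟩, i => PEmpty.elim i
    | ⟨.nexus, _⟩, i => PEmpty.elim i
    | ⟨.third, _⟩, i => PEmpty.elim i
    | ⟨.fifth, _⟩, i => PEmpty.elim i
    | ⟨.sixth, _⟩, i => PEmpty.elim i
  telMap j := PEmpty.elim j

/-- `𝒟_{≤5}` presented as `𝒟_{≤4}` extended by the observation vertex `Anab`.
[cite: MochizukiAbsTopIII2015, Corollary 3.6 (i) p.79] -/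
def core5Diagram : DiagramOfCategories coreShape5.{u}.Vertex := (Δ.sub 4).extend Δ.coreExt5

/-- The observable `(𝒟_{≤5}, v = Anab, ℋ)` on `𝒟_{≤4}`. [cite: MochizukiAbsTopIII2015, Corollary 3.6 (i) p.79] -/
def coreObs5 (H : Δ.core5Diagram.HomotopyFamily)
    (hH : ∀ ⦃a b : coreShape5.{u}.Vertex⦄ ⦃p q : Path a b⦄, H.E p q → b = coreShape5.{u}.obs) :
    (Δ.sub 4).Observable where
  shape := coreShape5
  isEmpty_J _ := inferInstanceAs (IsEmpty PEmpty)
  ext := Δ.coreExt5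
  H := H
  terminal_obs := hH

/-- **Cor. 3.6 (i), `n = 5`**: "`Anab` forms a core": the observable `(𝒟_{≤5}, Anab)` on `𝒟_{≤4}`
admits a core structure. [cite: MochizukiAbsTopIII2015, Corollary 3.6 (i) p.79] -/
def CoreStmt5 : Prop := ∃ H hH, (Δ.coreObs5 H hH).IsCore

/-- Observation-edge shape "`𝒟_{≤6}` on `𝒟_{≤5}`": the single edge `Anab → ℰ` (the projection).
[cite: MochizukiAbsTopIII2015, Corollary 3.6 (i) p.79] -/
def coreI6 : SubVertex {a : LFVertex | a.row ≤ 5} → Type u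
  | ⟨.fifth, _⟩ => PUnit
  | ⟨.row1 _, _⟩ => PEmpty
  | ⟨.nexus, _⟩ => PEmpty
  | ⟨.third, _⟩ => PEmpty
  | ⟨.fourth, _⟩ => PEmpty
  | ⟨.sixth, _⟩ => PEmpty

/-- The shape `𝒟_{≤5} ∪ {ℰ}`. [cite: MochizukiAbsTopIII2015, Corollary 3.6 (i) p.79] -/
def coreShape6 : ExtShape.{u} (SubVertex {a : LFVertex | a.row ≤ 5}) where
  I := coreI6.{u}
  J _ := PEmpty

/-- Extension data: `ℰ` at the observation vertex, the projection `Anab → ℰ` on the edge.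
[cite: MochizukiAbsTopIII2015, Corollary 3.6 (i) p.79] -/
def coreExt6 : (Δ.sub 5).ExtData coreShape6.{u} where
  S := Δ.E
  obsMap {a} i := match a, i with
    | ⟨.fifth, _⟩, _ => Δ.AtoE
    | ⟨.row1 _, _⟩, i => PEmpty.elim i
    | ⟨.nexus, _⟩, i => PEmpty.elim i
    | ⟨.third, _⟩, i => PEmpty.elim i
    | ⟨.fourth, _⟩, i => PEmpty.elim i
    | ⟨.sixth, _⟩, i => PEmpty.elim i
  telMap j := PEmpty.elim j

/-- `𝒟_{≤6} = 𝒟` presented as `𝒟_{≤5}` extended by the observation vertex `ℰ`.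
[cite: MochizukiAbsTopIII2015, Corollary 3.6 (i) p.79] -/
def core6Diagram : DiagramOfCategories coreShape6.{u}.Vertex := (Δ.sub 5).extend Δ.coreExt6

/-- The observable `(𝒟_{≤6}, v = ℰ, ℋ)` on `𝒟_{≤5}`. [cite: MochizukiAbsTopIII2015, Corollary 3.6 (i) p.79] -/
def coreObs6 (H : Δ.core6Diagram.HomotopyFamily)
    (hH : ∀ ⦃a b : coreShape6.{u}.Vertex⦄ ⦃p q : Path a b⦄, H.E p q → b = coreShape6.{u}.obs) :
    (Δ.sub 5).Observable where
  shape := coreShape6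
  isEmpty_J _ := inferInstanceAs (IsEmpty PEmpty)
  ext := Δ.coreExt6
  H := H
  terminal_obs := hH

/-- **Cor. 3.6 (i), `n = 6`**: the second copy of `ℰ` (row 6) forms a core of `𝒟_{≤5}`.
[cite: MochizukiAbsTopIII2015, Corollary 3.6 (i) p.79] -/
def CoreStmt6 : Prop := ∃ H hH, (Δ.coreObs6 H hH).IsCore


/-! ### Corollary 3.6 (iii): the log-Frobenius observable `𝔖_log` -/

section LogPaths

/-- The first-row vertex `⋎ = n` of `𝒟_{≤3}` (presentation `sub3`). [cite: MochizukiAbsTopIII2015, Corollary 3.6 (iii) p.80] -/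
def lvRow1 (n : ℤ) : logObsShape.{u}.Vertex :=
  logObsShape.{u}.base (vx 2 (.row1 n) (by simp [LFVertex.row]))

/-- The nexus `□` of `𝒟_{≤3}`. [cite: MochizukiAbsTopIII2015, Corollary 3.6 (iii) p.80] -/
def lvNexus : logObsShape.{u}.Vertex := logObsShape.{u}.base (vx 2 .nexus (by decide))

/-- The observation vertex `𝒩` of `𝒟_{≤3}`. [cite: MochizukiAbsTopIII2015, Corollary 3.6 (iii) p.80] -/
def lvObs : logObsShape.{u}.Vertex := logObsShape.{u}.obs

/-- The edge `λ^× : □ → 𝒩`. [cite: MochizukiAbsTopIII2015, Corollary 3.6 (iii) p.80] -/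
def eLamTimes : (lvNexus.{u} ⟶ lvObs.{u}) := (⟨true⟩ : ULift Bool)

/-- The edge `λ^{×pf} : □ → 𝒩`. [cite: MochizukiAbsTopIII2015, Corollary 3.6 (iii) p.80] -/
def eLamPf : (lvNexus.{u} ⟶ lvObs.{u}) := (⟨false⟩ : ULift Bool)

/-- `[λ^×] ∘ [id_⋎] ∘ [log]` from `⋎+1` (left path of the type-(1) pair of the proof of (iii), p. 81).
[cite: MochizukiAbsTopIII2015, Corollary 3.6 (iii) p.81] -/
def logPairLeft (n : ℤ) : Path (lvRow1.{u} (n + 1)) lvObs.{u} :=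
  (((Path.nil : Path (lvRow1.{u} (n + 1)) (lvRow1 (n + 1))).cons
    (show lvRow1.{u} (n + 1) ⟶ lvRow1 n from LFVertex.logEdge n)).cons
    (show lvRow1.{u} n ⟶ lvNexus from LFVertex.idEdge n)).cons eLamTimes

/-- `[λ^{×pf}] ∘ [id_{⋎+1}]` from `⋎+1` (right path of the type-(1) pair).
[cite: MochizukiAbsTopIII2015, Corollary 3.6 (iii) p.81] -/
def logPairRight (n : ℤ) : Path (lvRow1.{u} (n + 1)) lvObs.{u} :=
  ((Path.nil : Path (lvRow1.{u} (n + 1)) (lvRow1 (n + 1))).cons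
    (show lvRow1.{u} (n + 1) ⟶ lvNexus from LFVertex.idEdge (n + 1))).cons eLamPf

/-- `[id_{⋎+1}]` from `⋎+1` to `□` (left path of the would-be core pair in the proof of (iv), p. 81).
[cite: MochizukiAbsTopIII2015, Corollary 3.6 (iv) p.81] -/
def corePathId (n : ℤ) : Path (lvRow1.{u} (n + 1)) lvNexus.{u} :=
  (Path.nil : Path (lvRow1.{u} (n + 1)) (lvRow1 (n + 1))).cons
    (show lvRow1.{u} (n + 1) ⟶ lvNexus from LFVertex.idEdge (n + 1))

/-- `[id_⋎] ∘ [log]` from `⋎+1` to `□` (right path of the would-be core pair, p. 81).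
[cite: MochizukiAbsTopIII2015, Corollary 3.6 (iv) p.81] -/
def corePathLog (n : ℤ) : Path (lvRow1.{u} (n + 1)) lvNexus.{u} :=
  ((Path.nil : Path (lvRow1.{u} (n + 1)) (lvRow1 (n + 1))).cons
    (show lvRow1.{u} (n + 1) ⟶ lvRow1 n from LFVertex.logEdge n)).cons
    (show lvRow1.{u} n ⟶ lvNexus from LFVertex.idEdge n)

/-- Left path of the basic type-(2) pair: `[λ^×]` in §3 (`ι_× : λ^× → λ^{×pf}`), `[λ^∼]` in §4
(`ι_× : λ^∼ → λ^×`, Cor. 4.5), according to the direction flag `ιtimes`.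
[cite: MochizukiAbsTopIII2015, Corollary 3.6 (iii) p.81] -/
def timesPairLeft : Path lvNexus.{u} lvObs.{u} :=
  match Δ.ιtimes with
  | .inl _ => (Path.nil : Path lvNexus.{u} lvNexus).cons eLamTimes
  | .inr _ => (Path.nil : Path lvNexus.{u} lvNexus).cons eLamPf

/-- Right path of the basic type-(2) pair. [cite: MochizukiAbsTopIII2015, Corollary 3.6 (iii) p.81] -/
def timesPairRight : Path lvNexus.{u} lvObs.{u} :=
  match Δ.ιtimes with
  | .inl _ => (Path.nil : Path lvNexus.{u} lvNexus).cons eLamPf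
  | .inr _ => (Path.nil : Path lvNexus.{u} lvNexus).cons eLamTimes

/-- The GENERATORS of the boundary set `E_log` of `𝔖_log` (proof of (iii), p. 81): type (1)
`([λ^×]∘[id_⋎]∘[log]∘[γ], [λ^{×pf}]∘[id_{⋎+1}]∘[γ])` and type (2) `([λ^×]∘[γ], [λ^{×pf}]∘[γ])` are the
pre-compositions of these basic pairs; type (3) `([γ],[γ])` are the reflexive pairs a saturated
set contains automatically. [cite: MochizukiAbsTopIII2015, Corollary 3.6 (iii) p.81] -/
inductive LogGen : ∀ ⦃a b : logObsShape.{u}.Vertex⦄, Path a b → Path a b → Prop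
  | type1 (n : ℤ) : LogGen (logPairLeft n) (logPairRight n)
  | type2 : LogGen Δ.timesPairLeft Δ.timesPairRight

/-- "`ι_{log,⋎}` (respectively, `ι_×`) determine(s) the homotopies for pairs of paths of type (1)
(respectively, (2))": a family `ℋ` on `𝒟_{≤3}` CONTAINS the basic pairs with exactly these natural
transformations as homotopies (components compared through `eqToHom` of the object equalities).
[cite: MochizukiAbsTopIII2015, Corollary 3.6 (iii) p.81] -/
def LogPinned (H : Δ.sub3.HomotopyFamily) : Prop :=
  (match Δ.ιtimes with
    | .inl ι => ∃ h : H.E ((Path.nil : Path lvNexus.{u} lvNexus).cons eLamTimes)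
          ((Path.nil : Path lvNexus.{u} lvNexus).cons eLamPf),
        ∀ (x : Δ.X) (e₁ : (Δ.sub3.pathFunctor ((Path.nil : Path lvNexus.{u} lvNexus).cons eLamTimes)).obj x
            = Δ.lamTimes.obj x)
          (e₂ : (Δ.sub3.pathFunctor ((Path.nil : Path lvNexus.{u} lvNexus).cons eLamPf)).obj x
            = Δ.lamPf.obj x),
          (H.η h).app x = eqToHom e₁ ≫ ι.app x ≫ eqToHom e₂.symm
    | .inr ι => ∃ h : H.E ((Path.nil : Path lvNexus.{u} lvNexus).cons eLamPf)
          ((Path.nil : Path lvNexus.{u} lvNexus).cons eLamTimes),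
        ∀ (x : Δ.X) (e₁ : (Δ.sub3.pathFunctor ((Path.nil : Path lvNexus.{u} lvNexus).cons eLamPf)).obj x
            = Δ.lamPf.obj x)
          (e₂ : (Δ.sub3.pathFunctor ((Path.nil : Path lvNexus.{u} lvNexus).cons eLamTimes)).obj x
            = Δ.lamTimes.obj x),
          (H.η h).app x = eqToHom e₁ ≫ ι.app x ≫ eqToHom e₂.symm) ∧
  ∀ n : ℤ, ∃ h : H.E (logPairLeft n) (logPairRight n),
    ∀ (x : Δ.X₁)
      (e₁ : (Δ.sub3.pathFunctor (logPairLeft n)).obj x = Δ.lamTimes.obj (Δ.toNexus.obj (Δ.log.obj x)))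
      (e₂ : (Δ.sub3.pathFunctor (logPairRight n)).obj x = Δ.lamPf.obj (Δ.toNexus.obj x)),
      (H.η h).app x = eqToHom e₁ ≫ Δ.ιlog.app x ≫ eqToHom e₂.symm

end LogPaths

/-- The observable `𝔖_log = (𝒟_{≤3}, v = 𝒩, ℋ)` on `𝒟_{≤2}` determined by a family `ℋ` on `𝒟_{≤3}` whose
boundary paths end at `𝒩`. [cite: MochizukiAbsTopIII2015, Corollary 3.6 (iii) p.80] -/
def logObs (H : Δ.sub3.HomotopyFamily)
    (hH : ∀ ⦃a b : logObsShape.{u}.Vertex⦄ ⦃p q : Path a b⦄, H.E p q → b = logObsShape.{u}.obs) :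
    (Δ.sub 2).Observable where
  shape := logObsShape
  isEmpty_J _ := inferInstanceAs (IsEmpty PEmpty)
  ext := Δ.logObsExt
  H := H
  terminal_obs := hH

/-- **Cor. 3.6 (iii)**: "The natural transformations `ι_{log,⋎} : λ^× ∘ id_⋎ ∘ log → λ^{×pf} ∘ id_{⋎+1}`,
`ι_× : λ^× → λ^{×pf}` belong to a family of homotopies on `𝒟_{≤3}` that determines on `𝒟_{≤3}` a
structure of observable `𝔖_log` on `𝒟_{≤2}`" — typed: a family on `𝒟_{≤3}` generated (Def. 3.5 (ii))
by the type-(1)/(2) pairs (`LogGen`), with `ι_{log,⋎}`, `ι_×` as the homotopies on the generators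
(`LogPinned`); its boundary paths end at `𝒩` (stated; it also follows from the generation) and
`logObs` is the observable `𝔖_log`.  NOT typed: the
clause "compatible with the families of homotopies that constitute the core and telecore
structures of (i), (ii)" (module docstring).
[cite: MochizukiAbsTopIII2015, Corollary 3.6 (iii) p.80] -/
def ObservableLogStmt : Prop :=
  ∃ H : Δ.sub3.HomotopyFamily, HomotopyFamily.IsGeneratedBy _ H Δ.LogGen ∧
    (∀ ⦃a b : logObsShape.{u}.Vertex⦄ ⦃p q : Path a b⦄, H.E p q → b = logObsShape.{u}.obs) ∧
    Δ.LogPinned H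

/-! ### Corollary 3.6 (iv), first half: no core on `𝒟_{≤1}` compatible with `𝔖_log` -/

/-- **Cor. 3.6 (iv), first incompatibility**: "`𝒟_{≤2}` does not admit a structure of core on `𝒟_{≤1}`
which [i.e., whose constituent family of homotopies] is compatible with [the constituent family of
homotopies of] the observable `𝔖_log` of (iii)."  Typed (abc-iut-L4-t2's reading, which implies
the printed one: a core structure on `𝒟_{≤1}` compatible with `𝔖_log` yields such a family): there
is NO family of homotopies on `𝒟_{≤3}` containing, for every `⋎`, an isomorphism for the co-verticial
pair `([id_{⋎+1}], [id_⋎]∘[log])` (the homotopy `ζ₀` of the proof, p. 81) together with the `𝔖_log`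
pairs carrying `ι_{log,⋎}`, `ι_×` (whence, by saturation, the equation contradicting Lemma 3.4).
[cite: MochizukiAbsTopIII2015, Corollary 3.6 (iv) pp.80–81] -/
def IncompatibleStmt : Prop :=
  ¬ ∃ K : Δ.sub3.HomotopyFamily,
      (∀ n : ℤ, ∃ h₀ : K.E (corePathId n) (corePathLog n), IsIso (K.η h₀)) ∧ Δ.LogPinned K

/-! ### Corollary 3.6 (v): nexus, total `□`-rigidity, the `ℤ`-action -/

/-- **Cor. 3.6 (v)**, first part: "The unique vertex `□` of the second row of `𝒟` is a nexus of `Γ⃗_𝒟`.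
Moreover, `𝒟` is totally `□`-rigid" (pre-nexus portion = the first row; Def. 3.5 (vi)).
[cite: MochizukiAbsTopIII2015, Corollary 3.6 (v) p.80] -/
def NexusRigidStmt : Prop := Δ.diagram.IsTotallyNexusRigid .nexus {a : LFVertex | a.row = 1}

/-- **Cor. 3.6 (v)**, second part: "the natural action of `ℤ` on the infinite linear oriented graph
`Γ⃗_{𝒟_{≤1}}` extends to an action of `ℤ` on `𝒟` by nexus-classes of self-equivalences of `𝒟`" — for
every `m : ℤ` a nexus self-equivalence (Def. 3.5 (vi)) translating the first row by `m`, with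
`Φ_0 ≅ id` and `Φ_m ∘ Φ_{m'} ≅ Φ_{m+m'}` up to 2-isomorphism (an action by isomorphism CLASSES).
NOT typed: the closing compatibility sentences of (v) (module docstring).
[cite: MochizukiAbsTopIII2015, Corollary 3.6 (v) p.80] -/
def ShiftStmt : Prop :=
  ∃ Φ : ℤ → Δ.diagram.SelfEquivalence,
    (∀ m, (Φ m).IsNexusClass .nexus {a : LFVertex | a.row = 1}) ∧
    (∀ m n : ℤ, (Φ m).graphMap.obj (.row1 n) = .row1 (n + m)) ∧
    (∃ h₀ : (Φ 0).graphMap = 𝟭q LFVertex,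
      (h₀ ▸ (Φ 0).hom).Isomorphic (OneMorphism.id Δ.diagram)) ∧
    (∀ m m' : ℤ, ∃ h : (Φ m).graphMap ⋙q (Φ m').graphMap = (Φ (m + m')).graphMap,
      (h ▸ ((Φ m).hom.comp (Φ m').hom)).Isomorphic (Φ (m + m')).hom)

end LogFrobeniusData

end Literature.AnabelianGeometry.AbsoluteAnabelian
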